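import Mathlib.Analysis.InnerProductSpace.Adjoint
import Literature.Analysis.FluidPDE.ConfinedHardSphereFlow
import HarnessLib

/-!
# Hard spheres among MOVING specular walls: the reflection law, trajectories and the two-time flow

`N` hard spheres of diameter `ε` in a position space `X` with a `Geometry d X` (flat torus or
`ℝᵈ`, `HardSpherePhaseSpace`) move among walls whose position depends on time and which carry a
prescribed velocity: free flight, elastic binary collisions (`collidePair`), and, when a sphere
touches a wall, the ELASTIC REFLECTION OFF AN INFINITELY HEAVY MOVING WALL — in the rest frame of
the wall the relative velocity is specularly reflected,
`v ↦ w + R_{n^⊥}(v - w) = v - 2 ⟪v - w, n⟫ n` (`n` the unit normal, `w` the wall velocity at the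
contact). This is the infinite-mass limit of the two-body law (Wright 2007 §4.1–4.2: the piston /
gas-particle collision `v⊥⁺ = ((1-M) v⊥⁻ + 2M V⁻)/(1+M) → -v⊥⁻ + 2V` as `M → ∞`) and the rule of
the piston with PRESCRIBED trajectory `X(t), V(t)` of Chernov–Lebowitz–Sinai 2002 §3 ("collisions
with the piston `(x_{t+0}, v_{t+0}) = (x_{t-0}, 2V(t) - v_{t-0})` whenever `x_{t-0} = X(t)` […] for
each `t > 0` the map `Fᵗ` is a bijection of `G` and preserves area, `det DFᵗ = 1`").
It is the dynamics of the PISTON GAS of route `Summits/AtomisticToContinuum/HydrodynamicLimit/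
Theses/AdiabaticPistons` (massless specular walls transported by the Euler velocity), of an
affinely deformed Lagrangian cell, and — with velocity `0` — of hard spheres in a fixed vessel
(`ConfinedHardSphereFlow`, e.g. the box `Wall.box`; Simányi 1999).

Contents (everything mirrors `ConfinedHardSphereFlow.lean`, whose static `Wall d X` — admissible
region OF THE CENTRES, contact set, inner unit normal — is reused as the time-`t` snapshot):

* `movingSpecularReflect n w v = w + specularReflect n (v - w)` and its algebra (explicit formula,
  `= specularReflect` for `w = 0`, involution, `|v' - w| = |v - w|`, `⟪v' - w, n⟫ = -⟪v - w, n⟫`,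
  `⟪v', n⟫ = 2⟪w, n⟫ - ⟪v, n⟫` (CLS 2002 `v⁺ = 2V - v⁻`), Galilean covariance, only the normal
  component of `w` matters); `reflectMovingWall W w i z` on configurations;
  `IsMovingWallIncoming/Outgoing` (`⟪vᵢ - w, n⟫ < 0 / > 0`).
* `MovingWall d X = (wall : ℝ → Wall d X, vel : ℝ → X → ℝᵈ)`: ONE smooth moving wall component as
  seen by the centres at each time, with the wall velocity at the contact of a sphere centred at
  `x`; a moving vessel / wall grid is a family `W : ι → MovingWall d X`; `wallsAt W t : ι → Wall d X`
  is its time-`t` snapshot, so the time-`t` phase space and Liouville measure are the existing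
  `confinedDomain G (wallsAt W t) N ε` and `confinedLiouville G (wallsAt W t) N ε`;
  `MovingWall.static W` (velocity `0`); `movingWallCollisionTimes`, `movingEventTimes`.
* `IsMovingWallHardSphereTrajectoryOn G W ε N I γ`: on the time set `I` (an interval: `univ`,
  `Ici 0`, `Ico 0 T`), the clauses of `IsConfinedHardSphereTrajectory` with time-dependent walls,
  left limits taken inside `I`, and the moving reflection law at wall contacts.
* `MovingWallHardSphereFlow G W ε N I`: the HYPOTHESIS STRUCTURE of the a.e.-defined NON-AUTONOMOUS
  flow — good sets `good s` of full time-`s` Liouville measure inside the time-`s` domain, a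
  measurable two-time flow map `flow s t` with `flow s s = id` and the cocycle (Chapman–Kolmogorov)
  property `flow t u ∘ flow s t = flow s u` on good sets, mapping `good s` to `good t`, whose orbits
  are moving-wall trajectories on `I`, and which pushes the time-`s` Liouville measure to the
  time-`t` one (volume preservation of billiards with moving walls, CLS 2002 §3 `det DFᵗ = 1`).
  API: `lawAt`, `transportFn`, inverse/injectivity on good sets, the degenerate inhabitant `zero`.
  EXISTENCE (an Alexander-type theorem with moving walls) is NOT part of the definition and is not
  vendored here (no printed source states it in this generality).
* The static case: `IsConfinedHardSphereTrajectory ↔ IsMovingWallHardSphereTrajectoryOn … univ`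
  for `MovingWall.static`, time-shift invariance, and the embeddings
  `ConfinedHardSphereFlow.toMovingWall`, `HardSphereFlow.toMovingWall` (`flow s t = Φ_{t-s}`).
* Constructors for the three special cases requested by the route: (a) FIXED BOX —
  `BoxHardSphereFlow L ε N = ConfinedHardSphereFlow (Euclidean.geometry d) (Wall.box L ε) ε N`
  (hard spheres in `∏ [0, Lᵢ]`, Simányi 1999) and its moving-wall view; (b) AFFINELY DEFORMED
  CELL `A(t) · Q` — `MovingWall.affineHalfSpace A A' m c ε` (a flat face transported by
  `x ↦ A(t) x`, inner normal `(A(t)⁻¹)† m` normalised, centres inset by `ε/2`, wall velocity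
  `A'(t) A(t)⁻¹ y` at the physical contact point `y = x - (ε/2) n`) and `MovingWall.affineCell`;
  (c) the PISTON GAS on the torus — `Wall.thin G S ρ` (a thin two-sided wall / arbitrary obstacle
  set `S`, exclusion radius `ρ = ε/2` for the centres, normal along the separation vector from the
  foot point `Wall.foot`), `MovingWall.thin` (transported set `S t` with material velocity `u t` read
  at the foot point), `Torus.gridPlane`, `Torus.pistonWalls Xt u m ε` (the images under a map
  `Xt t` of the `m`-grid planes of `𝕋ᵈ`, velocity `u`), `Torus.IsFlowMapOn` (the relation
  "`Xt` is the Lagrangian flow map of `u` on `I`", via lifts to `ℝᵈ`), `PistonGasFlow`.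

## Mathlib / Literature reuse

`Wall`, `Wall.halfSpace/ball/box`, `confinedDomain`, `wallContactSet`, `confinedLiouville`,
`reflectWall`, `IsWallIncoming`, `IsConfinedHardSphereTrajectory`, `ConfinedHardSphereFlow`
(`ConfinedHardSphereFlow.lean`); `FunctionSpaces.specularReflect = ((ℝ ∙ n)ᗮ).reflection`
(`LorentzGas.lean`, Mathlib's `Submodule.reflection`); `collidePair`, `freeFlight`, `IsIncoming`,
`collisionTimes`, `HardSphereFlow` (`HardSpherePhaseSpace/Dynamics`); `ContinuousLinearMap.adjoint`,
`ContinuousLinearEquiv`, `HasDerivWithinAt`, `nhdsWithin`, `MeasurePreserving`, `Measure.map`,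
`UnitAddTorus`, `FunctionSpaces.Torus.proj` are Mathlib's / `FlatTorus`'. Mathlib has no billiard
dynamics at all (`lean search 'billiard|moving wall|piston'`: 0 Mathlib hits; the Literature hits are
the static files above and this route's docstrings).

## Design choices

* Walls act on CENTRES (the convention of `Wall`): constructors take the offset `ε/2` explicitly.
  `MovingWall.vel t x` is the velocity of the wall at the contact of a sphere centred at `x`; only
  its normal component enters the law (`movingSpecularReflect_add_of_inner_eq_zero`), and for a
  flat face moving affinely the normal velocity of the inset face at `x` equals that of the
  physical face at `y = x - (ε/2) n` (documented at `affineHalfSpace`).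
* The flow is TWO-TIME (`flow s t`, a cocycle on a time set `I`), not a one-parameter group: the
  walls make the dynamics non-autonomous. No initial time is distinguished; the route's "time-`0`
  good set of full Liouville measure" is `good 0`. Left limits at event times are taken in
  `𝓝[I ∩ Iio t] t`, so that nothing is required before the first instant of `I` (at `t = inf I` an
  initial contact configuration must merely be post-collisional).
* As for `HardSphereFlow` / `ConfinedHardSphereFlow`, the structure bundles hypotheses; outside
  the good sets (and outside `I`) the values of `flow` are junk. Energy is NOT conserved at a
  moving wall (the wall works on the gas — the adiabatic piston); `|vᵢ - w|` is.
* `Wall.thin` treats a sphere touching an arbitrary closed obstacle set through the foot point of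
  its centre (impulse along centre-minus-contact-point, the smooth-ball law); where the foot point
  is not unique (corners, focal points) the normal is a junk choice — such contacts are multiple /
  singular events, to be excluded by the good set of any existence theorem, exactly as corner hits
  of a billiard. One `MovingWall` per grid plane in `Torus.pistonWalls`, so that touching two
  planes at once is a multiple event of `IsMovingWallHardSphereTrajectoryOn.wall`.

## References

* N. Chernov, J. L. Lebowitz, Ya. G. Sinai, *Dynamics of a massive piston in an ideal gas*,
  Russian Math. Surveys 57:6 (2002) 1045–1125, §3 (prescribed piston trajectory: free motion,
  reflections `v ↦ -v` at the fixed walls, `v ↦ 2V(t) - v` at the piston, right-continuous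
  trajectories, `Fᵗ` bijective and area preserving). [ChernovLebowitzSinai2002]
* P. Wright, *The periodic oscillation of an adiabatic piston in two or three dimensions*, Comm.
  Math. Phys. 275 (2007), §3.1 (gas container, billiard flow, Liouville measure), §4.1–4.2 (the
  collision law and its `M → ∞` expansion). [Wright2007]
* C. Cercignani, R. Illner, M. Pulvirenti, *The Mathematical Theory of Dilute Gases* (1994), §4.2
  (2.2) (specular reflection at `∂Λ`, inner normal), Thm. 4.2.1. [CIP1994]
* N. Simányi, *Ergodicity of hard spheres in a box*, Ergodic Theory Dynam. Systems 19 (1999).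
  [Simanyi1999]
* The route file `Summits/AtomisticToContinuum/HydrodynamicLimit/Theses/AdiabaticPistons.lean`
  (piston gas, wall transparency, affinely deformed Lagrangian cells).
-/

open MeasureTheory Metric Real Set Filter Topology
open scoped InnerProductSpace

namespace Literature.Analysis.FluidPDE

noncomputable section

section Kinetic

variable {d : Type*} [Fintype d] {X : Type*} {N : ℕ} {ι : Type*}

/-! ## The reflection law off a moving wall -/

/-- ELASTIC REFLECTION OFF A MOVING WALL at the level of one velocity: for a wall with (inner)
normal direction `n` (any nonzero multiple) moving with velocity `w` at the contact point, the
outgoing velocity of an incoming particle of velocity `v` is `w + R_{n^⊥}(v - w)` — boost to the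
rest frame of the wall, reflect specularly (`FunctionSpaces.specularReflect`), boost back; i.e.
`v - 2 (⟪v - w, n⟫/|n|²) n` (`movingSpecularReflect_eq`). The infinite-mass limit of the piston /
particle collision law (Wright 2007 §4.2; CLS 2002 §3: `v ↦ 2V(t) - v` for the normal component).
[cite: ChernovLebowitzSinai2002, §3] -/
def movingSpecularReflect (n w v : EuclideanSpace ℝ d) : EuclideanSpace ℝ d :=
  w + FunctionSpaces.specularReflect n (v - w)

/-- In the rest frame of the wall the law is the specular reflection of the relative velocity. [folklore] -/
theorem movingSpecularReflect_sub (n w v : EuclideanSpace ℝ d) :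
    movingSpecularReflect n w v - w = FunctionSpaces.specularReflect n (v - w) :=
  add_sub_cancel_left w _

/-- For a wall at rest the law is the specular reflection (`reflectWall` / Lorentz-gas law,
CIP 1994 §4.2 (2.2)). [cite: CIP1994, §4.2 (2.2)] -/
@[simp]
theorem movingSpecularReflect_zero_vel (n v : EuclideanSpace ℝ d) :
    movingSpecularReflect n 0 v = FunctionSpaces.specularReflect n v := by
  simp [movingSpecularReflect]

/-- The explicit formula `v' = v - 2 (⟪v - w, n⟫ / |n|²) n`. [cite: ChernovLebowitzSinai2002, §3] -/
theorem movingSpecularReflect_eq (n w v : EuclideanSpace ℝ d) :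
    movingSpecularReflect n w v = v - (2 * ⟪v - w, n⟫_ℝ / ‖n‖ ^ 2) • n := by
  rw [movingSpecularReflect, FunctionSpaces.specularReflect_eq]
  abel

/-- For a unit normal: `v' = v - 2 ⟪v - w, n⟫ n` (the form `v ↦ v - 2((v - w)·n) n` of the route's
definition request). [cite: ChernovLebowitzSinai2002, §3] -/
theorem movingSpecularReflect_eq_of_norm_eq_one {n : EuclideanSpace ℝ d} (hn : ‖n‖ = 1)
    (w v : EuclideanSpace ℝ d) : movingSpecularReflect n w v = v - (2 * ⟪v - w, n⟫_ℝ) • n := by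
  rw [movingSpecularReflect_eq, hn, one_pow, div_one]

/-- Junk value: for the zero normal the law is the identity. [folklore] -/
@[simp]
theorem movingSpecularReflect_zero_normal (w v : EuclideanSpace ℝ d) :
    movingSpecularReflect 0 w v = v := by
  simp [movingSpecularReflect_eq]

/-- The speed RELATIVE TO THE WALL is preserved (the reflection is an isometry in the wall frame;
the kinetic energy in the laboratory frame is not — the moving wall does work). [folklore] -/
theorem norm_movingSpecularReflect_sub (n w v : EuclideanSpace ℝ d) :
    ‖movingSpecularReflect n w v - w‖ = ‖v - w‖ := by
  rw [movingSpecularReflect_sub, norm_specularReflect]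

/-- The normal relative velocity is reversed: `⟪v' - w, n⟫ = -⟪v - w, n⟫`. [folklore] -/
theorem inner_movingSpecularReflect_sub_left (n w v : EuclideanSpace ℝ d) :
    ⟪movingSpecularReflect n w v - w, n⟫_ℝ = -⟪v - w, n⟫_ℝ := by
  rw [movingSpecularReflect_sub, inner_specularReflect_left]

/-- The normal velocity after the reflection: `⟪v', n⟫ = 2 ⟪w, n⟫ - ⟪v, n⟫` — CLS 2002 §3
"`v_{t+0} = 2V(t) - v_{t-0}`" for the piston moving along the normal with velocity `V`.
[cite: ChernovLebowitzSinai2002, §3] -/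
theorem inner_movingSpecularReflect_left (n w v : EuclideanSpace ℝ d) :
    ⟪movingSpecularReflect n w v, n⟫_ℝ = 2 * ⟪w, n⟫_ℝ - ⟪v, n⟫_ℝ := by
  have h := inner_movingSpecularReflect_sub_left n w v
  rw [inner_sub_left, inner_sub_left] at h
  linarith

/-- The moving reflection (fixed `n`, `w`) is an involution. [folklore] -/
theorem movingSpecularReflect_movingSpecularReflect (n w v : EuclideanSpace ℝ d) :
    movingSpecularReflect n w (movingSpecularReflect n w v) = v := by
  rw [movingSpecularReflect, movingSpecularReflect_sub, specularReflect_specularReflect]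
  abel

/-- Galilean covariance: boosting wall and particle by the same velocity boosts the outcome. [folklore] -/
theorem movingSpecularReflect_add_right (n w v a : EuclideanSpace ℝ d) :
    movingSpecularReflect n (w + a) (v + a) = movingSpecularReflect n w v + a := by
  rw [movingSpecularReflect, movingSpecularReflect, add_sub_add_right_eq_sub]
  abel

/-- Only the NORMAL component of the wall velocity enters the law: a tangential change
`w ↦ w + τ`, `⟪τ, n⟫ = 0`, does not change the outgoing velocity (smooth wall, no friction). [folklore] -/
theorem movingSpecularReflect_add_of_inner_eq_zero (n w v τ : EuclideanSpace ℝ d)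
    (hτ : ⟪τ, n⟫_ℝ = 0) : movingSpecularReflect n (w + τ) v = movingSpecularReflect n w v := by
  simp only [movingSpecularReflect_eq, ← sub_sub, inner_sub_left, hτ, sub_zero]

/-! ## The reflection of one sphere at a moving wall -/

/-- REFLECTION OF SPHERE `i` AT THE WALL `W` MOVING WITH VELOCITY `w` (at the contact): its velocity
becomes `movingSpecularReflect (W.normal xᵢ) w vᵢ = vᵢ - 2 ⟪vᵢ - w, n⟫ n`; positions and the other
spheres are unchanged. For `w = 0` this is `reflectWall W i` (`reflectMovingWall_zero`).
[cite: ChernovLebowitzSinai2002, §3] -/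
def reflectMovingWall (W : Wall d X) (w : EuclideanSpace ℝ d) (i : Fin N) (z : Config N d X) :
    Config N d X :=
  Function.update z i ((z i).1, movingSpecularReflect (W.normal (z i).1) w (z i).2)

/-- After the reflection, sphere `i` keeps its position and has the reflected velocity. [folklore] -/
@[simp]
theorem reflectMovingWall_apply_self (W : Wall d X) (w : EuclideanSpace ℝ d) (i : Fin N)
    (z : Config N d X) :
    reflectMovingWall W w i z i = ((z i).1, movingSpecularReflect (W.normal (z i).1) w (z i).2) := by
  simp [reflectMovingWall]

/-- The other spheres are unaffected. [folklore] -/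
theorem reflectMovingWall_apply_of_ne (W : Wall d X) (w : EuclideanSpace ℝ d) {k i : Fin N}
    (hki : k ≠ i) (z : Config N d X) : reflectMovingWall W w i z k = z k := by
  simp [reflectMovingWall, Function.update_of_ne hki]

/-- A moving-wall reflection does not move the spheres. [folklore] -/
@[simp]
theorem reflectMovingWall_apply_fst (W : Wall d X) (w : EuclideanSpace ℝ d) (i : Fin N)
    (z : Config N d X) (k : Fin N) : (reflectMovingWall W w i z k).1 = (z k).1 := by
  by_cases hki : k = i
  · subst hki
    rw [reflectMovingWall_apply_self]
  · rw [reflectMovingWall_apply_of_ne W w hki]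

/-- For a wall at rest the moving-wall reflection is the specular wall reflection `reflectWall`. [folklore] -/
@[simp]
theorem reflectMovingWall_zero (W : Wall d X) (i : Fin N) (z : Config N d X) :
    reflectMovingWall W 0 i z = reflectWall W i z := by
  simp only [reflectMovingWall, reflectWall, movingSpecularReflect_zero_vel]

/-- The moving-wall reflection is an involution. [folklore] -/
theorem reflectMovingWall_reflectMovingWall (W : Wall d X) (w : EuclideanSpace ℝ d) (i : Fin N)
    (z : Config N d X) : reflectMovingWall W w i (reflectMovingWall W w i z) = z := by
  funext k
  by_cases hki : k = i
  · subst hki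
    rw [reflectMovingWall_apply_self, reflectMovingWall_apply_self,
      movingSpecularReflect_movingSpecularReflect]
  · rw [reflectMovingWall_apply_of_ne W w hki, reflectMovingWall_apply_of_ne W w hki]

/-- The speed of the reflected sphere relative to the wall is preserved. [folklore] -/
theorem norm_reflectMovingWall_snd_sub (W : Wall d X) (w : EuclideanSpace ℝ d) (i : Fin N)
    (z : Config N d X) : ‖(reflectMovingWall W w i z i).2 - w‖ = ‖(z i).2 - w‖ := by
  rw [reflectMovingWall_apply_self, norm_movingSpecularReflect_sub]

/-- Moving-wall reflections do not move spheres, so they preserve the hard-sphere domain. [folklore] -/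
@[simp]
theorem reflectMovingWall_mem_hardSphereDomain_iff {G : Geometry d X} {ε : ℝ} (W : Wall d X)
    (w : EuclideanSpace ℝ d) (i : Fin N) (z : Config N d X) :
    reflectMovingWall W w i z ∈ hardSphereDomain G N ε ↔ z ∈ hardSphereDomain G N ε := by
  simp [mem_hardSphereDomain]

/-- Moving-wall reflections preserve every confined domain. [folklore] -/
@[simp]
theorem reflectMovingWall_mem_confinedDomain_iff {G : Geometry d X} {W' : ι → Wall d X} {ε : ℝ}
    (W : Wall d X) (w : EuclideanSpace ℝ d) (i : Fin N) (z : Config N d X) :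
    reflectMovingWall W w i z ∈ confinedDomain G W' N ε ↔ z ∈ confinedDomain G W' N ε := by
  simp [mem_confinedDomain, mem_hardSphereDomain]

/-- Sphere `i` is INCOMING at the wall `W` moving with velocity `w`: its velocity relative to the
wall points against the inner normal, `⟪vᵢ - w, n(xᵢ)⟫ < 0` (Wright 2007 §4.2: "a collision can
only take place if `v₁⊥⁻ > εW⁻`"). [cite: Wright2007, §4.2] -/
def IsMovingWallIncoming (W : Wall d X) (w : EuclideanSpace ℝ d) (z : Config N d X) (i : Fin N) :
    Prop :=
  ⟪(z i).2 - w, W.normal (z i).1⟫_ℝ < 0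

/-- Sphere `i` is OUTGOING at the wall `W` moving with velocity `w`: `⟪vᵢ - w, n(xᵢ)⟫ > 0`. [folklore] -/
def IsMovingWallOutgoing (W : Wall d X) (w : EuclideanSpace ℝ d) (z : Config N d X) (i : Fin N) :
    Prop :=
  0 < ⟪(z i).2 - w, W.normal (z i).1⟫_ℝ

/-- For a wall at rest, moving-wall incoming is `IsWallIncoming`. [folklore] -/
@[simp]
theorem isMovingWallIncoming_zero_iff (W : Wall d X) (z : Config N d X) (i : Fin N) :
    IsMovingWallIncoming W 0 z i ↔ IsWallIncoming W z i := by
  simp [IsMovingWallIncoming, IsWallIncoming]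

/-- For a wall at rest, moving-wall outgoing is `IsWallOutgoing`. [folklore] -/
@[simp]
theorem isMovingWallOutgoing_zero_iff (W : Wall d X) (z : Config N d X) (i : Fin N) :
    IsMovingWallOutgoing W 0 z i ↔ IsWallOutgoing W z i := by
  simp [IsMovingWallOutgoing, IsWallOutgoing]

/-- The law exchanges incoming and outgoing configurations at a moving wall. [folklore] -/
theorem isMovingWallOutgoing_reflectMovingWall_iff (W : Wall d X) (w : EuclideanSpace ℝ d)
    (i : Fin N) (z : Config N d X) :
    IsMovingWallOutgoing W w (reflectMovingWall W w i z) i ↔ IsMovingWallIncoming W w z i := by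
  simp only [IsMovingWallOutgoing, IsMovingWallIncoming, reflectMovingWall_apply_self,
    inner_movingSpecularReflect_sub_left, neg_pos]

/-- Symmetrically, incoming after the reflection iff outgoing before. [folklore] -/
theorem isMovingWallIncoming_reflectMovingWall_iff (W : Wall d X) (w : EuclideanSpace ℝ d)
    (i : Fin N) (z : Config N d X) :
    IsMovingWallIncoming W w (reflectMovingWall W w i z) i ↔ IsMovingWallOutgoing W w z i := by
  rw [← isMovingWallOutgoing_reflectMovingWall_iff W w i, reflectMovingWall_reflectMovingWall]

/-! ## Moving walls -/

/-- ONE MOVING WALL COMPONENT as seen by the sphere centres: at each time `t` a `Wall d X`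
(admissible closed region of a centre, contact positions, inner unit normal — the domain `Ω(t)`
shrunk by `ε/2`), together with the wall velocity `vel t x` at the contact of a sphere centred at
`x` (only its normal component `⟪vel, normal⟫`, the normal velocity of `∂Ω(t)`, enters the
dynamics). A moving vessel, an affinely deformed cell or a transported wall grid is a family
`ι → MovingWall d X`, one component per smooth piece (CLS 2002 §3: container walls at rest plus a
piston at `X(t)` with velocity `V(t)`; Wright 2007 §3.1). [cite: ChernovLebowitzSinai2002, §3] -/
structure MovingWall (d : Type*) [Fintype d] (X : Type*) where
  /-- The wall at time `t`, as seen by the centres. -/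
  wall : ℝ → Wall d X
  /-- The wall velocity at time `t` at the contact of a sphere centred at `x` (junk off contact). -/
  vel : ℝ → X → EuclideanSpace ℝ d

namespace MovingWall

/-- A wall AT REST: constant in time, velocity `0` (vessels, boxes, fixed scatterers:
`ConfinedHardSphereFlow`). [folklore] -/
def static (W : Wall d X) : MovingWall d X where
  wall _ := W
  vel _ _ := 0

/-- Unfolding lemma: a static wall is the given wall at all times. [folklore] -/
@[simp]
theorem static_wall (W : Wall d X) (t : ℝ) : (static W).wall t = W := rfl

/-- Unfolding lemma: a static wall has velocity `0`. [folklore] -/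
@[simp]
theorem static_vel (W : Wall d X) (t : ℝ) (x : X) : (static W).vel t x = 0 := rfl

end MovingWall

/-- The time-`t` snapshot of a family of moving walls: the walls `(W k).wall t`. The time-`t` phase
space and Liouville measure of the moving-wall system are `confinedDomain G (wallsAt W t) N ε` and
`confinedLiouville G (wallsAt W t) N ε`. [folklore] -/
def wallsAt (W : ι → MovingWall d X) (t : ℝ) : ι → Wall d X := fun k => (W k).wall t

/-- Unfolding lemma for `wallsAt`. [folklore] -/
@[simp]
theorem wallsAt_apply (W : ι → MovingWall d X) (t : ℝ) (k : ι) : wallsAt W t k = (W k).wall t := rfl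

/-- The snapshots of a family of static walls are the walls themselves. [folklore] -/
@[simp]
theorem wallsAt_static (W : ι → Wall d X) (t : ℝ) :
    wallsAt (fun k => MovingWall.static (W k)) t = W := rfl

/-! ## Event times with moving walls -/

/-- The wall collision times of a curve `γ` among moving walls: times `t` at which some sphere
touches some wall IN ITS TIME-`t` POSITION, `γ t ∈ wallContactSet G (wallsAt W t) N ε i k`
(CLS 2002 §3: "whenever `x_{t-0} = X(t)`"). [cite: ChernovLebowitzSinai2002, §3] -/
def movingWallCollisionTimes (G : Geometry d X) (W : ι → MovingWall d X) (ε : ℝ)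
    (γ : ℝ → Config N d X) : Set ℝ :=
  {t | ∃ (i : Fin N) (k : ι), γ t ∈ wallContactSet G (wallsAt W t) N ε i k}

/-- Membership in the set of moving-wall collision times. [folklore] -/
theorem mem_movingWallCollisionTimes {G : Geometry d X} {W : ι → MovingWall d X} {ε : ℝ}
    {γ : ℝ → Config N d X} {t : ℝ} :
    t ∈ movingWallCollisionTimes G W ε γ ↔
      ∃ (i : Fin N) (k : ι), γ t ∈ wallContactSet G (wallsAt W t) N ε i k :=
  Iff.rfl

/-- The EVENT times of a curve among moving walls: pair contacts or moving-wall contacts. [folklore] -/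
def movingEventTimes (G : Geometry d X) (W : ι → MovingWall d X) (ε : ℝ) (γ : ℝ → Config N d X) :
    Set ℝ :=
  collisionTimes G ε γ ∪ movingWallCollisionTimes G W ε γ

/-- Membership in the set of event times. [folklore] -/
theorem mem_movingEventTimes {G : Geometry d X} {W : ι → MovingWall d X} {ε : ℝ}
    {γ : ℝ → Config N d X} {t : ℝ} :
    t ∈ movingEventTimes G W ε γ ↔ t ∈ collisionTimes G ε γ ∨ t ∈ movingWallCollisionTimes G W ε γ :=
  Iff.rfl

/-- For static walls the moving-wall collision times are the wall collision times. [folklore] -/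
@[simp]
theorem movingWallCollisionTimes_static (G : Geometry d X) (W : ι → Wall d X) (ε : ℝ)
    (γ : ℝ → Config N d X) :
    movingWallCollisionTimes G (fun k => MovingWall.static (W k)) ε γ = wallCollisionTimes G W ε γ :=
  rfl

/-- For static walls the event times are those of `ConfinedHardSphereFlow.lean`. [folklore] -/
@[simp]
theorem movingEventTimes_static (G : Geometry d X) (W : ι → Wall d X) (ε : ℝ)
    (γ : ℝ → Config N d X) :
    movingEventTimes G (fun k => MovingWall.static (W k)) ε γ = eventTimes G W ε γ :=
  rfl

/-- With no walls there are no wall collision times. [folklore] -/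
@[simp]
theorem movingWallCollisionTimes_of_isEmpty [IsEmpty ι] (G : Geometry d X) (W : ι → MovingWall d X)
    (ε : ℝ) (γ : ℝ → Config N d X) : movingWallCollisionTimes G W ε γ = ∅ := by
  ext t
  simp [mem_movingWallCollisionTimes]

/-- With no walls the event times are the collision times. [folklore] -/
@[simp]
theorem movingEventTimes_of_isEmpty [IsEmpty ι] (G : Geometry d X) (W : ι → MovingWall d X)
    (ε : ℝ) (γ : ℝ → Config N d X) : movingEventTimes G W ε γ = collisionTimes G ε γ := by
  simp [movingEventTimes]

/-- The number of events (pair collisions and wall reflections) of `γ` in `[a, b]` (`Set.ncard`,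
junk value `0` if infinite). [folklore] -/
def numMovingEvents (G : Geometry d X) (W : ι → MovingWall d X) (ε : ℝ) (γ : ℝ → Config N d X)
    (a b : ℝ) : ℕ :=
  (movingEventTimes G W ε γ ∩ Icc a b).ncard

/-! ## Trajectories among moving walls -/

section Trajectory

variable [TopologicalSpace X]

/-- `γ : ℝ → Config N d X` is, ON THE TIME SET `I` (an interval: `univ`, `Ici 0`, `Ico 0 T`), a
HARD-SPHERE TRAJECTORY AMONG THE MOVING WALLS `W` (CLS 2002 §3; Wright 2007 §3.1, §4.2; CIP 1994
§4.2 for the static clauses): at each `t ∈ I` it lies in the time-`t` confined domain; its event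
times in `I` are locally finite; positions are continuous on `I`; it is free flight on event-free
stretches `(s, t]` of `I`; at a pair-contact time exactly that pair is in contact, no sphere is on
a wall, and the pair collides elastically from a pre-collisional left limit (taken inside `I`); at a
wall-contact time exactly that sphere–wall contact occurs, no pair is in contact, the left limit is
incoming RELATIVE TO THE MOVING WALL and the sphere's velocity is reflected off the moving wall,
`vᵢ ↦ vᵢ - 2 ⟪vᵢ - w, n⟫ n` with `w = (W k).vel t xᵢ` (right-continuous bookkeeping as in
`IsHardSphereTrajectory`). Values of `γ` outside `I` are irrelevant. [cite: ChernovLebowitzSinai2002, §3] -/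
structure IsMovingWallHardSphereTrajectoryOn (G : Geometry d X) (W : ι → MovingWall d X) (ε : ℝ)
    (N : ℕ) (I : Set ℝ) (γ : ℝ → Config N d X) : Prop where
  /-- At each time of `I` the configuration lies in the time-`t` confined domain. -/
  mem : ∀ t ∈ I, γ t ∈ confinedDomain G (wallsAt W t) N ε
  /-- Event times in `I` are locally finite. -/
  locFinite : ∀ a b, (movingEventTimes G W ε γ ∩ I ∩ Icc a b).Finite
  /-- Positions are continuous on `I`. -/
  pos_continuousOn : ∀ i, ContinuousOn (fun t => (γ t i).1) I
  /-- Free flight on event-free stretches `(s, t]` of `I`. -/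
  free : ∀ s ∈ I, ∀ t ∈ I, s ≤ t → (∀ τ ∈ Ioc s t, τ ∉ movingEventTimes G W ε γ) →
    γ t = freeFlight G (t - s) (γ s)
  /-- At a pair-contact time: that pair is the only one in contact, no sphere touches a wall (in
  its current position), and the pair collides elastically from a pre-collisional left limit. -/
  binary : ∀ t ∈ I, ∀ (i j : Fin N), i ≠ j → γ t ∈ contactSet G N ε i j →
    (∀ i' j' : Fin N, i' ≠ j' → γ t ∈ contactSet G N ε i' j' →
      ({i', j'} : Finset (Fin N)) = {i, j}) ∧
    (∀ (i' : Fin N) (k : ι), (γ t i').1 ∉ ((W k).wall t).contact) ∧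
    ∃ zl, Tendsto γ (𝓝[I ∩ Iio t] t) (𝓝 zl) ∧ IsIncoming G zl i j ∧ γ t = collidePair G i j zl
  /-- At a wall-contact time: that sphere–wall contact is the only one, no pair is in contact, and
  the sphere is reflected off the moving wall from a left limit incoming relative to the wall. -/
  wall : ∀ t ∈ I, ∀ (i : Fin N) (k : ι), (γ t i).1 ∈ ((W k).wall t).contact →
    (∀ (i' : Fin N) (k' : ι), (γ t i').1 ∈ ((W k').wall t).contact → i' = i ∧ k' = k) ∧
    (∀ i' j' : Fin N, i' ≠ j' → γ t ∉ contactSet G N ε i' j') ∧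
    ∃ zl, Tendsto γ (𝓝[I ∩ Iio t] t) (𝓝 zl) ∧
      IsMovingWallIncoming ((W k).wall t) ((W k).vel t (γ t i).1) zl i ∧
      γ t = reflectMovingWall ((W k).wall t) ((W k).vel t (γ t i).1) i zl

namespace IsMovingWallHardSphereTrajectoryOn

variable {G : Geometry d X} {W : ι → MovingWall d X} {ε : ℝ} {I : Set ℝ} {γ : ℝ → Config N d X}

/-- A moving-wall trajectory stays in the hard-sphere domain on `I`. [folklore] -/
theorem mem_hardSphereDomain (h : IsMovingWallHardSphereTrajectoryOn G W ε N I γ) {t : ℝ}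
    (ht : t ∈ I) : γ t ∈ hardSphereDomain G N ε :=
  (h.mem t ht).1

/-- Along a moving-wall trajectory every centre is admissible for every wall in its current
position. [folklore] -/
theorem pos_mem_region (h : IsMovingWallHardSphereTrajectoryOn G W ε N I γ) {t : ℝ} (ht : t ∈ I)
    (i : Fin N) (k : ι) : (γ t i).1 ∈ ((W k).wall t).region :=
  (h.mem t ht).2 i k

/-- A moving-wall trajectory with no event in `(s, t]` is free flight there. [folklore] -/
theorem eq_freeFlight (h : IsMovingWallHardSphereTrajectoryOn G W ε N I γ) {s t : ℝ} (hs : s ∈ I)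
    (ht : t ∈ I) (hst : s ≤ t) (hfree : ∀ τ ∈ Ioc s t, τ ∉ movingEventTimes G W ε γ) :
    γ t = freeFlight G (t - s) (γ s) :=
  h.free s hs t ht hst hfree

/-- Pair-collision times in `I` are locally finite. [folklore] -/
theorem locFinite_collisionTimes (h : IsMovingWallHardSphereTrajectoryOn G W ε N I γ) (a b : ℝ) :
    (collisionTimes G ε γ ∩ I ∩ Icc a b).Finite :=
  (h.locFinite a b).subset
    (inter_subset_inter_left _ (inter_subset_inter_left _ subset_union_left))

/-- Wall-collision times in `I` are locally finite. [folklore] -/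
theorem locFinite_movingWallCollisionTimes (h : IsMovingWallHardSphereTrajectoryOn G W ε N I γ)
    (a b : ℝ) : (movingWallCollisionTimes G W ε γ ∩ I ∩ Icc a b).Finite :=
  (h.locFinite a b).subset
    (inter_subset_inter_left _ (inter_subset_inter_left _ subset_union_right))

/-- Restriction to a smaller time set (a sub-interval). [folklore] -/
theorem mono (h : IsMovingWallHardSphereTrajectoryOn G W ε N I γ) {J : Set ℝ} (hJ : J ⊆ I) :
    IsMovingWallHardSphereTrajectoryOn G W ε N J γ where
  mem t ht := h.mem t (hJ ht)
  locFinite a b := (h.locFinite a b).subset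
    (inter_subset_inter_left _ (inter_subset_inter_right _ hJ))
  pos_continuousOn i := (h.pos_continuousOn i).mono hJ
  free s hs t ht hst hfree := h.free s (hJ hs) t (hJ ht) hst hfree
  binary t ht i j hij hc := by
    obtain ⟨h1, h2, zl, hzl, hin, hval⟩ := h.binary t (hJ ht) i j hij hc
    exact ⟨h1, h2, zl, hzl.mono_left (nhdsWithin_mono t (inter_subset_inter_left _ hJ)), hin, hval⟩
  wall t ht i k hc := by
    obtain ⟨h1, h2, zl, hzl, hin, hval⟩ := h.wall t (hJ ht) i k hc
    exact ⟨h1, h2, zl, hzl.mono_left (nhdsWithin_mono t (inter_subset_inter_left _ hJ)), hin, hval⟩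

end IsMovingWallHardSphereTrajectoryOn

/-! ### Static walls: the moving-wall trajectories on `univ` are the confined trajectories -/

namespace IsConfinedHardSphereTrajectory

variable {G : Geometry d X} {W : ι → Wall d X} {ε : ℝ} {γ : ℝ → Config N d X}

/-- Confined hard-sphere trajectories are invariant under time shifts: `t ↦ γ (t - c)` is again a
confined trajectory (the walls do not move). [folklore] -/
theorem comp_sub_right (h : IsConfinedHardSphereTrajectory G W ε N γ) (c : ℝ) :
    IsConfinedHardSphereTrajectory G W ε N fun t => γ (t - c) := by
  have htr : ∀ t : ℝ, Tendsto (fun s : ℝ => s - c) (𝓝[<] t) (𝓝[<] (t - c)) := fun t =>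
    (continuous_sub_right c).continuousWithinAt.tendsto_nhdsWithin fun s hs => by
      have hs' : s < t := hs
      show s - c < t - c
      linarith
  refine ⟨fun t => h.mem _, fun a b => ?_, fun i => ?_, fun s t hst hfree => ?_,
    fun t i j hij hc => ?_, fun t i k hc => ?_⟩
  · refine ((h.locFinite (a - c) (b - c)).image fun t => t + c).subset ?_
    rintro t ⟨ht, hta, htb⟩
    exact ⟨t - c, ⟨ht, by linarith, by linarith⟩, by ring⟩
  · exact (h.pos_continuous i).comp (continuous_sub_right c)
  · show γ (t - c) = freeFlight G (t - s) (γ (s - c))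
    have hf := h.free (s - c) (t - c) (by linarith) fun σ hσ => ?_
    · rw [hf]
      congr 1
      ring
    · have hσ' := hfree (σ + c) ⟨by linarith [hσ.1], by linarith [hσ.2]⟩
      change ¬ (σ + c - c ∈ eventTimes G W ε γ) at hσ'
      rwa [add_sub_cancel_right] at hσ'
  · obtain ⟨huniq, hnw, zl, hzl, hin, hval⟩ := h.binary (t - c) i j hij hc
    exact ⟨huniq, hnw, zl, hzl.comp (htr t), hin, hval⟩
  · obtain ⟨huniq, hnp, zl, hzl, hin, hval⟩ := h.wall (t - c) i k hc
    exact ⟨huniq, hnp, zl, hzl.comp (htr t), hin, hval⟩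

/-- A confined hard-sphere trajectory among the walls `W` is a moving-wall trajectory on all of
`ℝ` for the static walls `MovingWall.static (W k)` (velocity `0`: the moving law is `reflectWall`). [folklore] -/
theorem isMovingWallHardSphereTrajectoryOn (h : IsConfinedHardSphereTrajectory G W ε N γ) :
    IsMovingWallHardSphereTrajectoryOn G (fun k => MovingWall.static (W k)) ε N univ γ where
  mem t _ := h.mem t
  locFinite a b := by
    have h' : (eventTimes G W ε γ ∩ univ ∩ Icc a b).Finite := by
      rw [inter_univ]
      exact h.locFinite a b
    exact h'
  pos_continuousOn i := (h.pos_continuous i).continuousOn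
  free s _ t _ hst hfree := h.free s t hst hfree
  binary t _ i j hij hc := by
    obtain ⟨h1, h2, zl, hzl, hin, hval⟩ := h.binary t i j hij hc
    refine ⟨h1, h2, zl, ?_, hin, hval⟩
    rwa [univ_inter]
  wall t _ i k hc := by
    obtain ⟨h1, h2, zl, hzl, hin, hval⟩ := h.wall t i k hc
    refine ⟨h1, h2, zl, ?_, ?_, ?_⟩
    · rwa [univ_inter]
    · simpa using hin
    · simpa using hval

/-- Conversely, a moving-wall trajectory on `univ` for static walls is a confined trajectory. [folklore] -/
theorem of_isMovingWallHardSphereTrajectoryOn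
    (h : IsMovingWallHardSphereTrajectoryOn G (fun k => MovingWall.static (W k)) ε N univ γ) :
    IsConfinedHardSphereTrajectory G W ε N γ where
  mem t := h.mem t (mem_univ t)
  locFinite a b := by
    have h' : (eventTimes G W ε γ ∩ univ ∩ Icc a b).Finite := h.locFinite a b
    rwa [inter_univ] at h'
  pos_continuous i := continuousOn_univ.1 (h.pos_continuousOn i)
  free s t hst hfree := h.free s (mem_univ s) t (mem_univ t) hst hfree
  binary t i j hij hc := by
    obtain ⟨h1, h2, zl, hzl, hin, hval⟩ := h.binary t (mem_univ t) i j hij hc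
    refine ⟨h1, h2, zl, ?_, hin, hval⟩
    rwa [univ_inter] at hzl
  wall t i k hc := by
    obtain ⟨h1, h2, zl, hzl, hin, hval⟩ := h.wall t (mem_univ t) i k hc
    refine ⟨h1, h2, zl, ?_, ?_, ?_⟩
    · rwa [univ_inter] at hzl
    · simpa using hin
    · simpa using hval

/-- For static walls, `IsMovingWallHardSphereTrajectoryOn … univ ↔ IsConfinedHardSphereTrajectory`. [folklore] -/
theorem _root_.Literature.Analysis.FluidPDE.isMovingWallHardSphereTrajectoryOn_static_iff :
    IsMovingWallHardSphereTrajectoryOn G (fun k => MovingWall.static (W k)) ε N univ γ ↔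
      IsConfinedHardSphereTrajectory G W ε N γ :=
  ⟨of_isMovingWallHardSphereTrajectoryOn, isMovingWallHardSphereTrajectoryOn⟩

end IsConfinedHardSphereTrajectory

end Trajectory

/-! ## The two-time flow among moving walls (hypothesis structure) -/

section Flow

variable [MeasureSpace X] [TopologicalSpace X]

/-- THE HARD-SPHERE FLOW AMONG MOVING WALLS, on the time set `I`, bundled with its defining
properties — the NON-AUTONOMOUS analogue of `ConfinedHardSphereFlow` / `HardSphereFlow`
(CLS 2002 §3: the family `Fᵗ` determined by the prescribed wall trajectory, "for each `t > 0` the map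
`Fᵗ` is a bijection of `G` and preserves area"; Wright 2007 §3.1; Alexander 1975 / CIP 1994
Thm. 4.2.1 for the a.e. good set): for each time `s ∈ I` a measurable GOOD SET `good s` inside the
time-`s` confined domain, of full time-`s` Liouville measure; a two-time flow map `flow s t`
(state at time `t` of the motion that is at the given state at time `s`; both time orders) with
`flow s s = id` and the cocycle property `flow t u ∘ flow s t = flow s u` on good sets, mapping
`good s` into `good t`, each `flow s t` measurable; every orbit `t ↦ flow s t z`, `z ∈ good s`, is
a moving-wall hard-sphere trajectory on `I`; and `flow s t` pushes the time-`s` Liouville measure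
`confinedLiouville G (wallsAt W s) N ε` to the time-`t` one (phase volume is preserved by billiards
with moving walls). Outside the good sets and outside `I` the values of `flow` are junk. Its
EXISTENCE for concrete moving walls is a separate statement, not recorded here. [cite: ChernovLebowitzSinai2002, §3] -/
structure MovingWallHardSphereFlow (G : Geometry d X) (W : ι → MovingWall d X) (ε : ℝ) (N : ℕ)
    (I : Set ℝ) where
  /-- The two-time flow map `(s, t, z) ↦ Φ_{s,t} z`. -/
  flow : ℝ → ℝ → Config N d X → Config N d X
  /-- The good set of time-`s` data. -/
  good : ℝ → Set (Config N d X)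
  /-- Good sets are measurable. -/
  measurableSet_good : ∀ s ∈ I, MeasurableSet (good s)
  /-- The time-`s` good set lies in the time-`s` confined domain. -/
  good_subset : ∀ s ∈ I, good s ⊆ confinedDomain G (wallsAt W s) N ε
  /-- The time-`s` good set has full time-`s` Liouville measure. -/
  measure_compl_good : ∀ s ∈ I, confinedLiouville G (wallsAt W s) N ε (good s)ᶜ = 0
  /-- The flow maps good sets to good sets. -/
  mapsTo_good : ∀ s ∈ I, ∀ t ∈ I, MapsTo (flow s t) (good s) (good t)
  /-- `Φ_{s,s} = id` on the good set. -/
  flow_self : ∀ s ∈ I, ∀ z ∈ good s, flow s s z = z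
  /-- The cocycle property `Φ_{t,u} ∘ Φ_{s,t} = Φ_{s,u}` on the good set. -/
  flow_trans : ∀ s ∈ I, ∀ t ∈ I, ∀ u ∈ I, ∀ z ∈ good s, flow t u (flow s t z) = flow s u z
  /-- Each map `Φ_{s,t}` is measurable. -/
  measurable_flow : ∀ s ∈ I, ∀ t ∈ I, Measurable (flow s t)
  /-- Orbits of good points are moving-wall hard-sphere trajectories on `I`. -/
  isTrajectory : ∀ s ∈ I, ∀ z ∈ good s,
    IsMovingWallHardSphereTrajectoryOn G W ε N I fun t => flow s t z
  /-- `Φ_{s,t}` pushes the time-`s` Liouville measure to the time-`t` Liouville measure. -/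
  measurePreserving : ∀ s ∈ I, ∀ t ∈ I,
    MeasurePreserving (flow s t) (confinedLiouville G (wallsAt W s) N ε)
      (confinedLiouville G (wallsAt W t) N ε)

namespace MovingWallHardSphereFlow

variable {G : Geometry d X} {W : ι → MovingWall d X} {ε : ℝ} {I : Set ℝ}

/-- A moving-wall flow coerces to its two-time flow map. [folklore] -/
instance instCoeFun :
    CoeFun (MovingWallHardSphereFlow G W ε N I) fun _ => ℝ → ℝ → Config N d X → Config N d X :=
  ⟨MovingWallHardSphereFlow.flow⟩

/-- Almost every time-`s` configuration (for the time-`s` Liouville measure) is good. [folklore] -/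
theorem ae_mem_good (Φ : MovingWallHardSphereFlow G W ε N I) {s : ℝ} (hs : s ∈ I) :
    ∀ᵐ z ∂confinedLiouville G (wallsAt W s) N ε, z ∈ Φ.good s :=
  Φ.measure_compl_good s hs

/-- Good orbits stay in the time-dependent confined domain. [folklore] -/
theorem flow_mem_confinedDomain (Φ : MovingWallHardSphereFlow G W ε N I) {s t : ℝ} (hs : s ∈ I)
    (ht : t ∈ I) {z : Config N d X} (hz : z ∈ Φ.good s) :
    Φ.flow s t z ∈ confinedDomain G (wallsAt W t) N ε :=
  Φ.good_subset t ht (Φ.mapsTo_good s hs t ht hz)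

/-- `Φ_{t,s}` inverts `Φ_{s,t}` on the good set. [folklore] -/
theorem flow_flow_symm (Φ : MovingWallHardSphereFlow G W ε N I) {s t : ℝ} (hs : s ∈ I)
    (ht : t ∈ I) {z : Config N d X} (hz : z ∈ Φ.good s) : Φ.flow t s (Φ.flow s t z) = z := by
  rw [Φ.flow_trans s hs t ht s hs z hz, Φ.flow_self s hs z hz]

/-- `Φ_{s,t}` is injective on the good set. [folklore] -/
theorem injOn_flow (Φ : MovingWallHardSphereFlow G W ε N I) {s t : ℝ} (hs : s ∈ I) (ht : t ∈ I) :
    InjOn (Φ.flow s t) (Φ.good s) := fun z hz z' hz' h => by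
  rw [← Φ.flow_flow_symm hs ht hz, h, Φ.flow_flow_symm hs ht hz']

/-- `Φ_{s,t}` maps the time-`s` good set ONTO the time-`t` good set. [folklore] -/
theorem surjOn_flow (Φ : MovingWallHardSphereFlow G W ε N I) {s t : ℝ} (hs : s ∈ I) (ht : t ∈ I) :
    SurjOn (Φ.flow s t) (Φ.good s) (Φ.good t) := fun z hz =>
  ⟨Φ.flow t s z, Φ.mapsTo_good t ht s hs hz, Φ.flow_flow_symm ht hs hz⟩

/-- The law at time `t` of the system whose law at time `s` is `P`: the push-forward
`(Φ_{s,t})_* P`. [folklore] -/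
def lawAt (Φ : MovingWallHardSphereFlow G W ε N I) (P : Measure (Config N d X)) (s t : ℝ) :
    Measure (Config N d X) :=
  P.map (Φ.flow s t)

/-- Unfolding lemma for `lawAt`. [folklore] -/
@[simp]
theorem lawAt_eq (Φ : MovingWallHardSphereFlow G W ε N I) (P : Measure (Config N d X)) (s t : ℝ) :
    Φ.lawAt P s t = P.map (Φ.flow s t) := rfl

/-- Transport of the Liouville measures (restatement of `measurePreserving`): started from the
time-`s` Liouville measure, the law at time `t` is the time-`t` Liouville measure (CLS 2002 §3,
`det DFᵗ = 1`). [cite: ChernovLebowitzSinai2002, §3] -/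
theorem lawAt_confinedLiouville (Φ : MovingWallHardSphereFlow G W ε N I) {s t : ℝ} (hs : s ∈ I)
    (ht : t ∈ I) :
    Φ.lawAt (confinedLiouville G (wallsAt W s) N ε) s t = confinedLiouville G (wallsAt W t) N ε :=
  (Φ.measurePreserving s hs t ht).map_eq

/-- Transport of an observable: the time-`t` observable whose value is `F` read off at time `s`,
`(S_{s,t} F)(z) = F (Φ_{t,s} z)`. [folklore] -/
def transportFn (Φ : MovingWallHardSphereFlow G W ε N I) (F : Config N d X → ℝ) (s t : ℝ) :
    Config N d X → ℝ :=
  fun z => F (Φ.flow t s z)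

/-- Unfolding lemma for `transportFn`. [folklore] -/
@[simp]
theorem transportFn_apply (Φ : MovingWallHardSphereFlow G W ε N I) (F : Config N d X → ℝ)
    (s t : ℝ) (z : Config N d X) : Φ.transportFn F s t z = F (Φ.flow t s z) := rfl

/-- NO SPHERES (`N = 0`): the identity two-time flow on the one-point phase space is a moving-wall
flow for any geometry, walls and time set (a degenerate but honest inhabitant). [folklore] -/
def zero (G : Geometry d X) (W : ι → MovingWall d X) (ε : ℝ) (I : Set ℝ) :
    MovingWallHardSphereFlow G W ε 0 I where
  flow _ _ z := z
  good _ := univ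
  measurableSet_good _ _ := MeasurableSet.univ
  good_subset _ _ z _ := ⟨fun i => Fin.elim0 i, fun i => Fin.elim0 i⟩
  measure_compl_good _ _ := by simp
  mapsTo_good _ _ _ _ := mapsTo_univ _ _
  flow_self _ _ _ _ := rfl
  flow_trans _ _ _ _ _ _ _ _ := rfl
  measurable_flow _ _ _ _ := measurable_id
  isTrajectory s _ z _ :=
    { mem := fun _ _ => ⟨fun i => Fin.elim0 i, fun i => Fin.elim0 i⟩
      locFinite := fun a b => Set.finite_empty.subset (by
        rintro t ⟨⟨(⟨i, -⟩ | ⟨i, -⟩), -⟩, -⟩ <;> exact Fin.elim0 i)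
      pos_continuousOn := fun i => Fin.elim0 i
      free := fun _ _ _ _ _ _ => funext fun i => Fin.elim0 i
      binary := fun _ _ i => Fin.elim0 i
      wall := fun _ _ i => Fin.elim0 i }
  measurePreserving s _ t _ := by
    have h : ∀ r : ℝ, confinedDomain G (wallsAt W r) 0 ε = univ := fun r =>
      eq_univ_of_forall fun z => ⟨fun i => Fin.elim0 i, fun i => Fin.elim0 i⟩
    rw [confinedLiouville_eq, confinedLiouville_eq, h s, h t]
    exact MeasurePreserving.id _

end MovingWallHardSphereFlow

/-! ### Static walls: confined flows and hard-sphere flows as moving-wall flows -/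

/-- A CONFINED HARD-SPHERE FLOW (walls at rest) IS A MOVING-WALL FLOW on all of `ℝ` for the static
walls, with `flow s t = Φ_{t-s}` and the same good set at all times (special case (a) of the route's
request: hard spheres in a fixed vessel / box). [folklore] -/
def ConfinedHardSphereFlow.toMovingWall {G : Geometry d X} {W : ι → Wall d X} {ε : ℝ}
    (Φ : ConfinedHardSphereFlow G W ε N) :
    MovingWallHardSphereFlow G (fun k => MovingWall.static (W k)) ε N univ where
  flow s t := Φ.flow (t - s)
  good _ := Φ.good
  measurableSet_good _ _ := Φ.measurableSet_good
  good_subset _ _ := Φ.good_subset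
  measure_compl_good _ _ := Φ.measure_compl_good
  mapsTo_good s _ t _ := Φ.mapsTo_good (t - s)
  flow_self s _ z hz := by
    show Φ.flow (s - s) z = z
    rw [sub_self, Φ.flow_zero z hz]
  flow_trans s _ t _ u _ z hz := by
    show Φ.flow (u - t) (Φ.flow (t - s) z) = Φ.flow (u - s) z
    rw [← Φ.flow_add (u - t) (t - s) z hz, sub_add_sub_cancel]
  measurable_flow s _ t _ := Φ.measurable_flow (t - s)
  isTrajectory s _ z hz := ((Φ.isTrajectory z hz).comp_sub_right s).isMovingWallHardSphereTrajectoryOn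
  measurePreserving s _ t _ := Φ.measurePreserving (t - s)

/-- The flow map of the moving-wall view of a confined flow. [folklore] -/
@[simp]
theorem ConfinedHardSphereFlow.toMovingWall_flow {G : Geometry d X} {W : ι → Wall d X} {ε : ℝ}
    (Φ : ConfinedHardSphereFlow G W ε N) (s t : ℝ) : Φ.toMovingWall.flow s t = Φ.flow (t - s) := rfl

/-- The good sets of the moving-wall view of a confined flow. [folklore] -/
@[simp]
theorem ConfinedHardSphereFlow.toMovingWall_good {G : Geometry d X} {W : ι → Wall d X} {ε : ℝ}
    (Φ : ConfinedHardSphereFlow G W ε N) (s : ℝ) : Φ.toMovingWall.good s = Φ.good := rfl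

/-- A HARD-SPHERE FLOW (no walls) IS A MOVING-WALL FLOW for the empty family of walls. [folklore] -/
def HardSphereFlow.toMovingWall [IsEmpty ι] {G : Geometry d X} {ε : ℝ} (W : ι → Wall d X)
    (Φ : HardSphereFlow G ε N) :
    MovingWallHardSphereFlow G (fun k => MovingWall.static (W k)) ε N univ :=
  (ConfinedHardSphereFlow.ofHardSphereFlow (W := W) Φ).toMovingWall

/-- The flow map of the moving-wall view of a hard-sphere flow. [folklore] -/
@[simp]
theorem HardSphereFlow.toMovingWall_flow [IsEmpty ι] {G : Geometry d X} {ε : ℝ} (W : ι → Wall d X)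
    (Φ : HardSphereFlow G ε N) (s t : ℝ) : (Φ.toMovingWall W).flow s t = Φ.flow (t - s) := rfl

end Flow

/-! ## Special cases requested by the route -/

/-! ### (a) Hard spheres in a fixed box -/

/-- HARD SPHERES IN A FIXED BOX `∏ᵢ [0, Lᵢ] ⊂ ℝᵈ` with specular walls (velocity `0`): the confined
hard-sphere flow for the `2|d|` flat walls `Wall.box L ε` (centres in `∏ [ε/2, Lᵢ - ε/2]`) — the
setting of Simányi 1999 ("`N` hard balls in a rectangular box", ergodic for `N = 2`); as a
moving-wall flow: `ConfinedHardSphereFlow.toMovingWall`. [cite: Simanyi1999, §1] -/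
abbrev BoxHardSphereFlow [DecidableEq d] (L : d → ℝ) (ε : ℝ) (N : ℕ) : Type _ :=
  ConfinedHardSphereFlow (Euclidean.geometry d) (Wall.box L ε) ε N

/-! ### (b) A flat face transported by an affine motion; the affinely deformed cell `A(t) · Q` -/

namespace MovingWall

variable (A : ℝ → (EuclideanSpace ℝ d ≃L[ℝ] EuclideanSpace ℝ d))

/-- The (unnormalised) inner normal at time `t` of the flat face `{q | c ≤ ⟪q, m⟫}` transported by
`q ↦ A(t) q`: the covector `(A(t)⁻¹)† m`, so that `⟪x, n'(t)⟫ = ⟪A(t)⁻¹ x, m⟫`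
(`inner_affineNormal`). [folklore] -/
def affineNormal (m : EuclideanSpace ℝ d) (t : ℝ) : EuclideanSpace ℝ d :=
  ContinuousLinearMap.adjoint ((A t).symm : EuclideanSpace ℝ d →L[ℝ] EuclideanSpace ℝ d) m

/-- `⟪x, (A⁻¹)† m⟫ = ⟪A⁻¹ x, m⟫`. [folklore] -/
theorem inner_affineNormal (m : EuclideanSpace ℝ d) (t : ℝ) (x : EuclideanSpace ℝ d) :
    ⟪x, affineNormal A m t⟫_ℝ = ⟪(A t).symm x, m⟫_ℝ := by
  simp only [affineNormal, ContinuousLinearMap.adjoint_inner_right, ContinuousLinearEquiv.coe_coe]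

/-- The transported normal of a genuine face (`m ≠ 0`) is nonzero. [folklore] -/
theorem affineNormal_ne_zero {m : EuclideanSpace ℝ d} (hm : m ≠ 0) (t : ℝ) :
    affineNormal A m t ≠ 0 := by
  intro h0
  apply hm
  have h1 : ⟪(A t) m, affineNormal A m t⟫_ℝ = ⟪m, m⟫_ℝ := by
    rw [inner_affineNormal, ContinuousLinearEquiv.symm_apply_apply]
  rw [h0, inner_zero_right] at h1
  exact inner_self_eq_zero.1 h1.symm

/-- The inner UNIT normal at time `t` of the transported face. [folklore] -/
def unitAffineNormal (m : EuclideanSpace ℝ d) (t : ℝ) : EuclideanSpace ℝ d :=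
  ‖affineNormal A m t‖⁻¹ • affineNormal A m t

/-- The unit normal is a unit vector. [folklore] -/
theorem norm_unitAffineNormal {m : EuclideanSpace ℝ d} (hm : m ≠ 0) (t : ℝ) :
    ‖unitAffineNormal A m t‖ = 1 := by
  rw [unitAffineNormal, norm_smul, norm_inv, norm_norm,
    inv_mul_cancel₀ (norm_ne_zero_iff.2 (affineNormal_ne_zero A hm t))]

/-- A FLAT FACE TRANSPORTED BY AN AFFINE MOTION, as seen by the centres of spheres of diameter
`ε`: the physical half-space `{y | c ≤ ⟪A(t)⁻¹ y, m⟫} = A(t) · {q | c ≤ ⟪q, m⟫}` (`m ≠ 0` an inner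
normal of the reference face), i.e. `Wall.halfSpace n(t) (c/|n'(t)| + ε/2)` with
`n'(t) = (A(t)⁻¹)† m`, `n = n'/|n'|` and the inset `ε/2` for the centres
(`mem_affineHalfSpace_region_iff`); `A' t` is the time derivative `Ȧ(t)` of the motion (data), and the
wall velocity at the contact of a sphere centred at `x` is the material velocity
`Ȧ(t) A(t)⁻¹ y` of the physical contact point `y = x - (ε/2) n(t)` (its normal component is the
normal velocity of the inset face at `x`, since `⟪ṅ, n⟫ = 0`). The local model of an
Euler-transported Lagrangian cell of route AdiabaticPistons (special case (b)). [folklore] -/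
def affineHalfSpace (A' : ℝ → (EuclideanSpace ℝ d →L[ℝ] EuclideanSpace ℝ d))
    (m : EuclideanSpace ℝ d) (hm : m ≠ 0) (c ε : ℝ) : MovingWall d (EuclideanSpace ℝ d) where
  wall t := Wall.halfSpace (unitAffineNormal A m t) (norm_unitAffineNormal A hm t)
    (c / ‖affineNormal A m t‖ + ε / 2)
  vel t x := A' t ((A t).symm (x - (ε / 2) • unitAffineNormal A m t))

/-- A centre `x` is admissible for the transported face iff `c + (ε/2) |n'(t)| ≤ ⟪A(t)⁻¹ x, m⟫`,
i.e. iff `x` lies in the physical half-space `A(t) · {q | c ≤ ⟪q, m⟫}` at (Euclidean) distance at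
least `ε/2` from its boundary hyperplane. [folklore] -/
theorem mem_affineHalfSpace_region_iff (A' : ℝ → (EuclideanSpace ℝ d →L[ℝ] EuclideanSpace ℝ d))
    {m : EuclideanSpace ℝ d} (hm : m ≠ 0) (c ε t : ℝ) (x : EuclideanSpace ℝ d) :
    x ∈ ((affineHalfSpace A A' m hm c ε).wall t).region ↔
      c + ε / 2 * ‖affineNormal A m t‖ ≤ ⟪(A t).symm x, m⟫_ℝ := by
  have hr : 0 < ‖affineNormal A m t‖ := norm_pos_iff.2 (affineNormal_ne_zero A hm t)
  simp only [affineHalfSpace, Wall.halfSpace_region, mem_setOf_eq, unitAffineNormal,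
    inner_smul_right, inner_affineNormal]
  rw [← div_eq_inv_mul, le_div_iff₀ hr, add_mul, div_mul_cancel₀ c hr.ne']

/-- The unit normal of the transported face. [folklore] -/
@[simp]
theorem affineHalfSpace_wall_normal (A' : ℝ → (EuclideanSpace ℝ d →L[ℝ] EuclideanSpace ℝ d))
    {m : EuclideanSpace ℝ d} (hm : m ≠ 0) (c ε t : ℝ) (x : EuclideanSpace ℝ d) :
    ((affineHalfSpace A A' m hm c ε).wall t).normal x = unitAffineNormal A m t := rfl

/-- The wall velocity of the transported face at the contact of a sphere centred at `x`. [folklore] -/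
@[simp]
theorem affineHalfSpace_vel (A' : ℝ → (EuclideanSpace ℝ d →L[ℝ] EuclideanSpace ℝ d))
    {m : EuclideanSpace ℝ d} (hm : m ≠ 0) (c ε t : ℝ) (x : EuclideanSpace ℝ d) :
    (affineHalfSpace A A' m hm c ε).vel t x =
      A' t ((A t).symm (x - (ε / 2) • unitAffineNormal A m t)) := rfl

/-- THE AFFINELY DEFORMED CELL `Ω(t) = A(t) · Q` for the reference polytope
`Q = ⋂ₖ {q | c k ≤ ⟪q, m k⟫}` (inner normals `m k ≠ 0`), as a family of moving flat faces seen by the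
centres of spheres of diameter `ε` (special case (b) of the route's request; e.g. the unit cube with
`ι = d × Bool`, `m (i, false) = eᵢ, c = 0`, `m (i, true) = -eᵢ, c = -1`, cf. `Wall.box`). [folklore] -/
def affineCell (A' : ℝ → (EuclideanSpace ℝ d →L[ℝ] EuclideanSpace ℝ d)) (m : ι → EuclideanSpace ℝ d)
    (hm : ∀ k, m k ≠ 0) (c : ι → ℝ) (ε : ℝ) : ι → MovingWall d (EuclideanSpace ℝ d) :=
  fun k => affineHalfSpace A A' (m k) (hm k) (c k) ε

end MovingWall

/-! ### (c) Thin transported walls and the piston gas on the torus -/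

namespace Wall

open Classical in
/-- The FOOT POINT of a centre `x` on the obstacle set `S` at exclusion radius `ρ`: some point
`y ∈ S` with `|x - y| = ρ` (`G.sepVec`, minimal image on the torus) if there is one, else the junk
value `x`. At a regular contact it is the unique nearest wall point. [folklore] -/
def foot (G : Geometry d X) (S : Set X) (ρ : ℝ) (x : X) : X :=
  if h : ∃ y ∈ S, ‖G.sepVec x y‖ = ρ then h.choose else x

/-- The defining property of the foot point. [folklore] -/
theorem foot_spec {G : Geometry d X} {S : Set X} {ρ : ℝ} {x : X} (h : ∃ y ∈ S, ‖G.sepVec x y‖ = ρ) :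
    foot G S ρ x ∈ S ∧ ‖G.sepVec x (foot G S ρ x)‖ = ρ := by
  rw [foot, dif_pos h]
  exact h.choose_spec

/-- A THIN (two-sided) WALL, or an arbitrary closed obstacle set `S ⊆ X`, as seen by the centre of a
sphere kept at separation `≥ ρ` from every point of `S` (`ρ = ε/2` for a wall of zero thickness and
spheres of diameter `ε`; `ρ = R + ε/2` for a solid obstacle of which `S` is the boundary or the
body): region `{x | ∀ y ∈ S, ρ ≤ |x - y|}`, contact = region ∩ `{x | ∃ y ∈ S, |x - y| = ρ}`, inner
unit normal `ρ⁻¹ (x - y)` along the separation vector from the foot point `y = foot G S ρ x` — the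
impulse on a smooth ball acts along the line from the contact point to the centre. For
`S = {a}` this is `Wall.ball G a ρ` (`thin_singleton_region`). [folklore] -/
def thin (G : Geometry d X) (S : Set X) (ρ : ℝ) (hρ : 0 < ρ) : Wall d X where
  region := {x | ∀ y ∈ S, ρ ≤ ‖G.sepVec x y‖}
  contact := {x | (∀ y ∈ S, ρ ≤ ‖G.sepVec x y‖) ∧ ∃ y ∈ S, ‖G.sepVec x y‖ = ρ}
  contact_subset _ hx := hx.1
  normal x := ρ⁻¹ • G.sepVec x (foot G S ρ x)
  norm_normal x hx := by
    simp only [mem_setOf_eq] at hx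
    rw [norm_smul, norm_inv, Real.norm_eq_abs, abs_of_pos hρ, (foot_spec hx.2).2,
      inv_mul_cancel₀ hρ.ne']

/-- Unfolding lemma for the region of a thin wall. [folklore] -/
@[simp]
theorem thin_region (G : Geometry d X) (S : Set X) (ρ : ℝ) (hρ : 0 < ρ) :
    (thin G S ρ hρ).region = {x | ∀ y ∈ S, ρ ≤ ‖G.sepVec x y‖} := rfl

/-- Membership in the contact set of a thin wall. [folklore] -/
theorem mem_thin_contact {G : Geometry d X} {S : Set X} {ρ : ℝ} {hρ : 0 < ρ} {x : X} :
    x ∈ (thin G S ρ hρ).contact ↔ (∀ y ∈ S, ρ ≤ ‖G.sepVec x y‖) ∧ ∃ y ∈ S, ‖G.sepVec x y‖ = ρ :=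
  Iff.rfl

/-- Unfolding lemma for the normal of a thin wall. [folklore] -/
theorem thin_normal (G : Geometry d X) (S : Set X) (ρ : ℝ) (hρ : 0 < ρ) (x : X) :
    (thin G S ρ hρ).normal x = ρ⁻¹ • G.sepVec x (foot G S ρ x) := rfl

/-- A one-point obstacle is the round scatterer `Wall.ball` (same admissible region). [folklore] -/
theorem thin_singleton_region (G : Geometry d X) (a : X) (ρ : ℝ) (hρ : 0 < ρ) :
    (thin G {a} ρ hρ).region = (ball G a ρ hρ).region := by
  ext x
  simp

/-- With no obstacle every centre is admissible and none is in contact. [folklore] -/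
@[simp]
theorem thin_empty_region (G : Geometry d X) (ρ : ℝ) (hρ : 0 < ρ) :
    (thin G (∅ : Set X) ρ hρ).region = univ := by
  ext x
  simp

end Wall

namespace MovingWall

/-- A THIN WALL TRANSPORTED BY A MOTION: at time `t` the obstacle set is `S t` (e.g. the image
`Xt t '' S₀` of a reference wall under a Lagrangian map) with exclusion radius `ρ` for the centres
(`Wall.thin`), and the wall velocity at the contact of a sphere centred at `x` is the MATERIAL
velocity `u t y` of the wall read at the foot point `y = Wall.foot G (S t) ρ x` (the physical contact
point). The massless specular walls "transported by the Euler flow, `w = u`" of route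
AdiabaticPistons (special case (c)). [folklore] -/
def thin (G : Geometry d X) (S : ℝ → Set X) (u : ℝ → X → EuclideanSpace ℝ d) (ρ : ℝ) (hρ : 0 < ρ) :
    MovingWall d X where
  wall t := Wall.thin G (S t) ρ hρ
  vel t x := u t (Wall.foot G (S t) ρ x)

/-- Unfolding lemma for the snapshot of a transported thin wall. [folklore] -/
@[simp]
theorem thin_wall (G : Geometry d X) (S : ℝ → Set X) (u : ℝ → X → EuclideanSpace ℝ d) (ρ : ℝ)
    (hρ : 0 < ρ) (t : ℝ) : (thin G S u ρ hρ).wall t = Wall.thin G (S t) ρ hρ := rfl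

/-- Unfolding lemma for the velocity of a transported thin wall. [folklore] -/
@[simp]
theorem thin_vel (G : Geometry d X) (S : ℝ → Set X) (u : ℝ → X → EuclideanSpace ℝ d) (ρ : ℝ)
    (hρ : 0 < ρ) (t : ℝ) (x : X) : (thin G S u ρ hρ).vel t x = u t (Wall.foot G (S t) ρ x) := rfl

end MovingWall

namespace Torus

omit [Fintype d] in
/-- The GRID PLANE `{x | x_k = j/m}` of the `m`-grid (`δ = 1/m`) of the flat torus `𝕋ᵈ`, normal to
the `k`-th axis: a flat closed hypersurface (a `(d-1)`-subtorus); the faces of the `δ`-grid of route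
AdiabaticPistons are pieces of these planes. [folklore] -/
def gridPlane (k : d) (m j : ℕ) : Set (UnitAddTorus d) :=
  {x | x k = (((j : ℝ) / m : ℝ) : UnitAddCircle)}

omit [Fintype d] in
/-- Membership in a grid plane. [folklore] -/
theorem mem_gridPlane {k : d} {m j : ℕ} {x : UnitAddTorus d} :
    x ∈ gridPlane k m j ↔ x k = (((j : ℝ) / m : ℝ) : UnitAddCircle) :=
  Iff.rfl

/-- `Xt` IS THE LAGRANGIAN FLOW MAP OF THE VELOCITY FIELD `u` ON THE TIME SET `I` (on the torus,
through lifts to `ℝᵈ`): `Xt 0 = id` and for every `x` some lift `ξ` of `t ↦ Xt t x` along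
`Torus.proj` solves `ξ' = u(t, Xt t x)` within `I`. The relation between the wall motion and the
Euler velocity in the piston gas ("walls = `X_t`(grid faces), `w = u`"). [folklore] -/
def IsFlowMapOn (I : Set ℝ) (u : ℝ → UnitAddTorus d → EuclideanSpace ℝ d)
    (Xt : ℝ → UnitAddTorus d → UnitAddTorus d) : Prop :=
  ∀ x, Xt 0 x = x ∧ ∃ ξ : ℝ → EuclideanSpace ℝ d,
    (∀ t ∈ I, FunctionSpaces.Torus.proj (ξ t) = Xt t x) ∧ ∀ t ∈ I, HasDerivWithinAt ξ (u t (Xt t x)) I t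

/-- THE WALLS OF THE PISTON GAS: the `|d| · m` grid planes of the `m`-grid of `𝕋ᵈ` transported by the
map `Xt t` (the Lagrangian map of the Euler velocity `u`, `IsFlowMapOn`), as thin massless specular
walls of velocity `u` seen by the centres of spheres of diameter `ε` (exclusion radius `ε/2`), one
`MovingWall` per plane so that touching two planes at once is a multiple event (route
AdiabaticPistons, special case (c): "walls = `X_t`(faces of a `δ`-grid), `w = u`", `δ = 1/m`). [folklore] -/
def pistonWalls (Xt : ℝ → UnitAddTorus d → UnitAddTorus d) (u : ℝ → UnitAddTorus d → EuclideanSpace ℝ d)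
    (m : ℕ) (ε : ℝ) (hε : 0 < ε) : d × Fin m → MovingWall d (UnitAddTorus d) :=
  fun p => MovingWall.thin (Torus.geometry d) (fun t => Xt t '' gridPlane p.1 m p.2) u (ε / 2)
    (half_pos hε)

/-- Unfolding lemma: the snapshot of a piston wall is the thin wall on the transported plane. [folklore] -/
@[simp]
theorem pistonWalls_wall (Xt : ℝ → UnitAddTorus d → UnitAddTorus d)
    (u : ℝ → UnitAddTorus d → EuclideanSpace ℝ d) (m : ℕ) (ε : ℝ) (hε : 0 < ε) (p : d × Fin m)
    (t : ℝ) : (pistonWalls Xt u m ε hε p).wall t =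
      Wall.thin (Torus.geometry d) (Xt t '' gridPlane p.1 m p.2) (ε / 2) (half_pos hε) := rfl

/-- Unfolding lemma: the velocity of a piston wall is the Euler velocity at the foot point. [folklore] -/
@[simp]
theorem pistonWalls_vel (Xt : ℝ → UnitAddTorus d → UnitAddTorus d)
    (u : ℝ → UnitAddTorus d → EuclideanSpace ℝ d) (m : ℕ) (ε : ℝ) (hε : 0 < ε) (p : d × Fin m)
    (t : ℝ) (x : UnitAddTorus d) : (pistonWalls Xt u m ε hε p).vel t x =
      u t (Wall.foot (Torus.geometry d) (Xt t '' gridPlane p.1 m p.2) (ε / 2) x) := rfl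

end Torus

/-- THE PISTON-GAS FLOW of route AdiabaticPistons: `N` hard spheres of diameter `ε` on `𝕋ᵈ` among the
`m`-grid of thin specular walls transported by `Xt` with velocity `u`, on the time set `I`
(typically `Ico 0 T` for an Euler solution on `[0, T)`), as a `MovingWallHardSphereFlow`. The cells
of the transported grid are dynamically independent closed systems, so ONE moving cell `Xt t '' Q`
(the route's "piston cell") is this same flow with the time-`0` law supported in configurations whose
centres all lie in `Q`. [folklore] -/
abbrev PistonGasFlow (Xt : ℝ → UnitAddTorus d → UnitAddTorus d)
    (u : ℝ → UnitAddTorus d → EuclideanSpace ℝ d) (m : ℕ) (ε : ℝ) (hε : 0 < ε) (N : ℕ)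
    (I : Set ℝ) : Type _ :=
  MovingWallHardSphereFlow (Torus.geometry d) (Torus.pistonWalls Xt u m ε hε) ε N I

end Kinetic

end

end Literature.Analysis.FluidPDE
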